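import Mathlib
import Summits.ResolutionOfSingularities.ResolutionOfSingularities.Theorems.WeightedInvariantLocalWeightedDropTwistedTrivialTransportPrep

/-!
# `WeightedInvariant.LocalWeightedDrop`: TRANSPORT of origin-fixing twisted triviality by formal coordinate changes (R5.9, part 2)

Route `ResolutionOfSingularities/WeightedInvariant`, crux `LocalWeightedDrop` (stmt-ResolutionOfSingularities-8899); card A
of crux `WeightedConstruction` (stmt-ResolutionOfSingularities-0571).  [OURS · L1 W4.3] — KERNEL LANDING of ideator
res-L1-w43-idea-1's PROVED round-5 (sat′) transport stub `Transport.twistedTrivialAlongFix_subst_iff` (card A R5.9;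
`scratch-Transport.r5.lean` sha16 c3f5e653f8f1eef0, farm rc 0 · 0 sorries; recipe res-L1-w43-tri-2 O-v9.2 — `Ψ_σ(x) :=
θ(x + γ̂(σ)) − θ(γ̂(σ))`, invert `Θ = (σ, Ψ_σ)`, conjugate; check res-L1-w43-tri-1 §21 (i)); typed into the tree by
res-type-099 with idea-1's proofs VERBATIM (namespaces, docstrings, the name `FixTrivialExp` without the scratch's prime,
and the dictionary lemma `twistedTrivialAlongFix_iff_exists_fixTrivialExp` only).  Nothing here is a statement of the
manuscript under review on ladder RESOLUTION; AI-produced, weaker than expert review.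

* `TwistedTransport.fixTrivial_transport` — one direction with explicit data `(Φ, u) ↦ (Ω ∘ Φ ∘ θ, Ω u)`.
* `twistedTrivialAlongFix_subst_iff` — **TRANSPORT**: for a formal coordinate change `θ` (`θ(0) = 0`, `det lin θ` a unit)
  and a curve `γ` through the origin, `F ∘ θ` is Fix-trivial along `γ` iff `F` is Fix-trivial along `θ ∘ γ`
  (`(θ ∘ γ)ᵢ = subst γ (θ i)`), with the same Frobenius exponent (`fixTrivialExp_transport` / `…_inv` for the sketch's
  exponent-exposed predicate `FixTrivialExp`, Sketch-L1-idea-1 v5 §11c VERBATIM).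
* `TwistedTransport.straighten` / `fixTrivialExp_axis_of_smooth` — straightening a smooth arc transversal to `{x_{i₀} = 0}`
  onto the `x_{i₀}`-axis transports an exponent-`e` Fix-trivialisation along the arc to one along the axis (the tool of
  idea-1's TAME HALF of the e*-dichotomy, `exists_cylinder_of_fixTrivialExp_zero_smooth`, not landed here).
-/

set_option linter.dupNamespace false -- mandated namespace of this single-conjunct summit
set_option autoImplicit false

namespace Summit.ResolutionOfSingularities.ResolutionOfSingularities.Theorems

namespace GradedGame

open MvPowerSeries
open Literature.AlgebraicGeometry.Resolution
open Literature.AlgebraicGeometry.Resolution.FormalCoordChange (linMat exists_comp_inverse)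

variable {k : Type} [Field k]

variable {n : ℕ}

namespace TwistedTransport

/-- **TRANSPORT, one direction with explicit data** [OURS · L1 W4.3, round 5]: if `F ∘ θ` is Fix-trivial with exponent `q` along `γ`
(data `Φ, u`), then `F` is Fix-trivial with the same exponent along `θ ∘ γ` — recipe tri-2 O-v9.2. -/
theorem fixTrivial_transport (q : ℕ) (hq : 0 < q) (F : MvPowerSeries (Fin n) k)
    (θ : Fin n → MvPowerSeries (Fin n) k) (hθ0 : ∀ i, constantCoeff (θ i) = 0) (hθdet : IsUnit (linMat θ).det)
    (γ : Fin n → MvPowerSeries (Fin 1) k) (hγ : ∀ i, constantCoeff (γ i) = 0)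
    (Φ : Fin n → MvPowerSeries (Fin (n + 1)) k) (u : MvPowerSeries (Fin (n + 1)) k) (hu : IsUnit u)
    (hΦ0 : ∀ j, constantCoeff (Φ j) = 0) (hfix : ∀ j, subst (zfam (k := k) n) (Φ j) = 0)
    (hdet : IsUnit (Matrix.det (Matrix.of fun i j : Fin n => coeff (Finsupp.single j.succ 1) (Φ i))))
    (hid : subst (transl q γ) (subst θ F) = u * subst Φ (subst θ F)) :
    ∃ (Φ' : Fin n → MvPowerSeries (Fin (n + 1)) k) (u' : MvPowerSeries (Fin (n + 1)) k), IsUnit u' ∧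
      (∀ j, constantCoeff (Φ' j) = 0) ∧ (∀ j, subst (zfam (k := k) n) (Φ' j) = 0) ∧
      IsUnit (Matrix.det (Matrix.of fun i j : Fin n => coeff (Finsupp.single j.succ 1) (Φ' i))) ∧
      subst (transl q (fun i => subst γ (θ i))) F = u' * subst Φ' F := by
  classical
  -- (0) substitution data
  have hθs : HasSubst θ := hasSubst_of_constantCoeff_zero hθ0
  have hΦs : HasSubst Φ := hasSubst_of_constantCoeff_zero hΦ0
  have hghs : HasSubst (gh (k := k) q γ) := hasSubst_gh hq hγ
  have hTs : HasSubst (transl (k := k) q γ) := hasSubst_transl hq hγ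
  have hΨ0 : ∀ i, constantCoeff (psi q γ θ i) = 0 := constantCoeff_psi hq hγ hθ0
  have hΨfix : ∀ i, subst (zfam (k := k) n) (psi q γ θ i) = 0 := subst_zfam_psi hq hγ
  -- (2) Θ = (σ, Ψ) and its inverse Ω
  have hΘ0 := constantCoeff_theta hΨ0
  have hΘs := hasSubst_theta hΨ0
  have hlinΘ : (linMat (theta (psi q γ θ))).det = (linMat θ).det := by
    rw [Matrix.det_succ_row_zero, Fin.sum_univ_succ, Finset.sum_eq_zero, add_zero]
    · have h00 : linMat (theta (psi q γ θ)) 0 0 = 1 := by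
        simp [linMat, theta_zero]
      rw [h00]
      simp only [Fin.val_zero, pow_zero, one_mul, Fin.succAbove_zero]
      congr 1
      ext i j
      simp [Matrix.submatrix_apply, linMat, theta_succ, coeff_single_succ_psi hq hγ]
    · intro j _
      have : linMat (theta (psi q γ θ)) 0 j.succ = 0 := by
        simp [linMat, theta_zero, coeff_single_X, Fin.succ_ne_zero]
      rw [this]; ring
  have hΘdet : IsUnit (linMat (theta (psi q γ θ))).det := by rw [hlinΘ]; exact hθdet
  obtain ⟨Ω, hΩ0, hΩΘ, hΘΩ⟩ := exists_comp_inverse hΘ0 hΘdet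
  have hΩs : HasSubst Ω := hasSubst_of_constantCoeff_zero hΩ0
  have hΩ0X : Ω 0 = X 0 := by
    have h1 := hΩΘ 0
    rwa [theta_zero, subst_X hΩs] at h1
  have hz : ∀ v, subst (zfam (k := k) n) (theta (psi q γ θ) v) = zfam n v := by
    intro v
    refine Fin.cases ?_ (fun j => ?_) v
    · rw [theta_zero, subst_X hasSubst_zfam]
    · rw [theta_succ, hΨfix j]; simp [zfam, Fin.succ_ne_zero]
  have hΩfix : ∀ v, subst (zfam (k := k) n) (Ω v) = zfam n v := by
    intro v
    have h1 := congrArg (subst (zfam (k := k) n)) (hΘΩ v)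
    rw [subst_comp_subst_apply hΘs hasSubst_zfam, subst_X hasSubst_zfam] at h1
    have hfam : (fun s => subst (zfam n) (theta (psi q γ θ) s)) = zfam n := funext hz
    rwa [hfam] at h1
  -- the block relation MΨ * BΩ = 1
  have hMB : (Matrix.of fun i j : Fin n => coeff (Finsupp.single j.succ 1) (psi q γ θ i)) *
      (Matrix.of fun i j : Fin n => coeff (Finsupp.single j.succ 1) (Ω i.succ)) = 1 := by
    have hM := CobordantArc.linMat_mul_of_comp_eq_X (θ := theta (psi q γ θ)) (ψ := Ω) hΩ0 hΩΘ
    ext i j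
    have hij := congrArg (fun M : Matrix (Fin (n + 1)) (Fin (n + 1)) k => M i.succ j.succ) hM
    simp only [Matrix.mul_apply, Matrix.of_apply, Matrix.one_apply, Fin.succ_inj] at hij
    rw [Fin.sum_univ_succ, hΩ0X, coeff_single_X, if_neg (Fin.succ_ne_zero j), mul_zero, zero_add] at hij
    simp only [Matrix.mul_apply, Matrix.one_apply, Matrix.of_apply, theta_succ] at hij ⊢
    exact hij
  have hBΩdet : IsUnit (Matrix.of fun i j : Fin n => coeff (Finsupp.single j.succ 1) (Ω i.succ)).det := by
    have := congrArg Matrix.det hMB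
    rw [Matrix.det_mul, Matrix.det_one] at this
    exact IsUnit.of_mul_eq_one_right _ this
  -- (3) the new data
  have hΦθ0 : ∀ i, constantCoeff (subst Φ (θ i)) = 0 := fun i => constantCoeff_subst_eq_zero hΦs hΦ0 (hθ0 i)
  have hΦθs : HasSubst (fun i => subst Φ (θ i)) := hasSubst_of_constantCoeff_zero hΦθ0
  have hΦσ : ∀ l, coeff (Finsupp.single 0 1) (Φ l) = 0 := by
    intro l; rw [← coeff_single_zero_subst_zfam, hfix l, map_zero]
  refine ⟨fun i => subst Ω (subst Φ (θ i)), subst Ω u, ?_, ?_, ?_, ?_, ?_⟩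
  · rw [← coe_substAlgHom hΩs]; exact hu.map _
  · intro i; exact constantCoeff_subst_eq_zero hΩs hΩ0 (hΦθ0 i)
  · intro i
    rw [subst_comp_subst_apply hΩs hasSubst_zfam, funext hΩfix, subst_comp_subst_apply hΦs hasSubst_zfam,
      funext hfix]
    exact subst_zeroFamily (θ i) (hθ0 i)
  · -- linear part: M' = linMat θ * MΦ * BΩ
    have hGx : ∀ i : Fin n, ∀ v : Fin (n + 1), coeff (Finsupp.single v 1) (subst Φ (θ i)) =
        ∑ m, coeff (Finsupp.single m 1) (θ i) * coeff (Finsupp.single v 1) (Φ m) := fun i v =>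
      CobordantArc.coeff_degree_one_subst Φ hΦ0 (θ i) _ (by simp [Finsupp.degree_single])
    have hG0 : ∀ i : Fin n, coeff (Finsupp.single 0 1) (subst Φ (θ i)) = 0 := by
      intro i
      rw [hGx]
      refine Finset.sum_eq_zero fun m _ => ?_
      rw [hΦσ m, mul_zero]
    have hM' : ∀ i j : Fin n, coeff (Finsupp.single j.succ 1) (subst Ω (subst Φ (θ i))) =
        ∑ v : Fin n, coeff (Finsupp.single v.succ 1) (subst Φ (θ i)) * coeff (Finsupp.single j.succ 1) (Ω v.succ) := by
      intro i j
      rw [CobordantArc.coeff_degree_one_subst Ω hΩ0 _ _ (by simp [Finsupp.degree_single]), Fin.sum_univ_succ, hG0 i,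
        zero_mul, zero_add]
    have hlin : (Matrix.of fun i j : Fin n => coeff (Finsupp.single j.succ 1) (subst Ω (subst Φ (θ i)))) =
        linMat θ * (Matrix.of fun l v : Fin n => coeff (Finsupp.single v.succ 1) (Φ l)) *
          (Matrix.of fun i j : Fin n => coeff (Finsupp.single j.succ 1) (Ω i.succ)) := by
      ext i j
      rw [Matrix.of_apply, hM' i j, Matrix.mul_apply]
      refine Finset.sum_congr rfl fun v _ => ?_
      rw [Matrix.mul_apply, Matrix.of_apply, hGx i v.succ]
      rfl
    rw [hlin, Matrix.det_mul, Matrix.det_mul]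
    exact (hθdet.mul hdet).mul hBΩdet
  · -- the identity
    have hAs : HasSubst (fun s => subst (transl q γ) (θ s)) :=
      hasSubst_of_constantCoeff_zero fun s => constantCoeff_subst_eq_zero hTs (constantCoeff_transl hq hγ) (hθ0 s)
    have e1 := congrArg (subst Ω) hid
    rw [subst_comp_subst_apply hθs hTs, subst_mul hΩs, subst_comp_subst_apply hθs hΦs,
      subst_comp_subst_apply hAs hΩs, subst_comp_subst_apply hΦθs hΩs] at e1
    have hL : (fun s => subst Ω ((fun s => subst (transl q γ) (θ s)) s)) = transl q (fun i => subst γ (θ i)) := by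
      funext i
      have hAi : subst (transl q γ) (θ i) = psi q γ θ i + subst (gh q γ) (θ i) := by
        unfold psi; rw [sub_add_cancel]
      simp only []
      rw [hAi, subst_add hΩs]
      have h1 : subst Ω (psi q γ θ i) = X i.succ := by rw [← theta_succ (psi q γ θ) i]; exact hΩΘ i.succ
      have h2 : subst Ω (subst (gh q γ) (θ i)) = subst (gh q γ) (θ i) := by
        rw [subst_comp_subst_apply hghs hΩs]
        congr 1
        funext j
        exact subst_gh_of_zero hq γ hΩs hΩ0X j
      rw [h1, h2]
      unfold transl
      rw [gh_transport hq hγ θ i]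
    rw [hL] at e1
    exact e1

end TwistedTransport

open TwistedTransport

/-- **TRANSPORT of the tree predicate** (the (sat′) first lemma `stub_twistedTrivial_subst_iff`, PROVED) [OURS · L1 W4.3, round 5]:
`F ∘ θ` is twisted-trivial along `γ` iff `F` is twisted-trivial along `θ ∘ γ` (same Frobenius exponent). -/
theorem twistedTrivialAlongFix_subst_iff (p : ℕ) (hp : p ≠ 0) (F : MvPowerSeries (Fin n) k)
    (θ : Fin n → MvPowerSeries (Fin n) k) (hθ0 : ∀ i, constantCoeff (θ i) = 0) (hθdet : IsUnit (linMat θ).det)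
    (γ : Fin n → MvPowerSeries (Fin 1) k) (hγ : ∀ i, constantCoeff (γ i) = 0) :
    TwistedTrivialAlongFix p (subst θ F) γ ↔
      TwistedTrivialAlongFix p F (fun i => subst γ (θ i)) := by
  have hθs : HasSubst θ := hasSubst_of_constantCoeff_zero hθ0
  have hγs : HasSubst γ := hasSubst_of_constantCoeff_zero hγ
  have hγ' : ∀ i, constantCoeff (subst γ (θ i)) = 0 := fun i => constantCoeff_subst_eq_zero hγs hγ (hθ0 i)
  constructor
  · rintro ⟨-, e, Φ, u, hu, hΦ0, hfix, hdet, hid⟩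
    have hq : 0 < p ^ e := pow_pos (Nat.pos_of_ne_zero hp) e
    obtain ⟨Φ', u', hu', hΦ'0, hfix', hdet', hid'⟩ :=
      fixTrivial_transport (p ^ e) hq F θ hθ0 hθdet γ hγ Φ u hu hΦ0 hfix hdet hid
    exact ⟨hγ', e, Φ', u', hu', hΦ'0, hfix', hdet', hid'⟩
  · rintro ⟨-, e, Φ, u, hu, hΦ0, hfix, hdet, hid⟩
    have hq : 0 < p ^ e := pow_pos (Nat.pos_of_ne_zero hp) e
    obtain ⟨ψ, hψ0, hψθ, hθψ⟩ := exists_comp_inverse hθ0 hθdet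
    have hψs : HasSubst ψ := hasSubst_of_constantCoeff_zero hψ0
    have hψdet : IsUnit (linMat ψ).det := by
      have hM := CobordantArc.linMat_mul_of_comp_eq_X (θ := θ) (ψ := ψ) hψ0 hψθ
      have := congrArg Matrix.det hM
      rw [Matrix.det_mul, Matrix.det_one] at this
      exact IsUnit.of_mul_eq_one_right _ this
    have hFθψ : subst ψ (subst θ F) = F := by
      rw [subst_comp_subst_apply hθs hψs, funext hψθ]
      exact congr_fun subst_self F
    have hid1 : subst (transl (p ^ e) (fun i => subst γ (θ i))) (subst ψ (subst θ F)) =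
        u * subst Φ (subst ψ (subst θ F)) := by rw [hFθψ]; exact hid
    obtain ⟨Φ', u', hu', hΦ'0, hfix', hdet', hid'⟩ :=
      fixTrivial_transport (p ^ e) hq (subst θ F) ψ hψ0 hψdet (fun i => subst γ (θ i)) hγ' Φ u hu hΦ0 hfix hdet hid1
    have hpath : (fun i => subst (fun j => subst γ (θ j)) (ψ i)) = γ := by
      funext i
      rw [← subst_comp_subst_apply hθs hγs, hθψ i, subst_X hγs]
    rw [hpath] at hid'
    exact ⟨hγ, e, Φ', u', hu', hΦ'0, hfix', hdet', hid'⟩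

/-! ### Exponent bookkeeping and the straightening of smooth arcs -/

/-- The sketch's §11c `FixTrivialExp p e f γ` (VERBATIM): `TwistedTrivialAlongFix` with the Frobenius exponent `e` EXPOSED (the existential over `e` removed). [OURS · L1 W4.3, Sketch-L1-idea-1 v5 §11c] -/
def FixTrivialExp (p e : ℕ) {n : ℕ} (f : MvPowerSeries (Fin n) k) (γ : Fin n → MvPowerSeries (Fin 1) k) : Prop :=
  ∃ (Φ : Fin n → MvPowerSeries (Fin (n + 1)) k) (u : MvPowerSeries (Fin (n + 1)) k), IsUnit u ∧ (∀ j, constantCoeff (Φ j) = 0) ∧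
    (∀ j, subst (fun v : Fin (n + 1) => if v = 0 then (X (0 : Fin (n + 1)) : MvPowerSeries (Fin (n + 1)) k) else 0) (Φ j) = 0) ∧
    IsUnit (Matrix.det (Matrix.of fun i j : Fin n => coeff (Finsupp.single j.succ 1) (Φ i))) ∧
    subst (fun i : Fin n => X i.succ + subst (fun _ : Fin 1 => X (0 : Fin (n + 1)) ^ (p ^ e)) (γ i)) f = u * subst Φ f

/-- exponent-preserving transport, direct direction -/
theorem fixTrivialExp_transport (p : ℕ) (hp : p ≠ 0) (e : ℕ) (F : MvPowerSeries (Fin n) k)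
    (θ : Fin n → MvPowerSeries (Fin n) k) (hθ0 : ∀ i, constantCoeff (θ i) = 0) (hθdet : IsUnit (linMat θ).det)
    (γ : Fin n → MvPowerSeries (Fin 1) k) (hγ : ∀ i, constantCoeff (γ i) = 0) (h : FixTrivialExp p e (subst θ F) γ) :
    FixTrivialExp p e F (fun i => subst γ (θ i)) := by
  obtain ⟨Φ, u, hu, hΦ0, hfix, hdet, hid⟩ := h
  obtain ⟨Φ', u', hu', hΦ'0, hfix', hdet', hid'⟩ :=
    fixTrivial_transport (p ^ e) (pow_pos (Nat.pos_of_ne_zero hp) e) F θ hθ0 hθdet γ hγ Φ u hu hΦ0 hfix hdet hid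
  exact ⟨Φ', u', hu', hΦ'0, hfix', hdet', hid'⟩

/-- exponent-preserving transport, inverse direction -/
theorem fixTrivialExp_transport_inv (p : ℕ) (hp : p ≠ 0) (e : ℕ) (F : MvPowerSeries (Fin n) k)
    (θ : Fin n → MvPowerSeries (Fin n) k) (hθ0 : ∀ i, constantCoeff (θ i) = 0) (hθdet : IsUnit (linMat θ).det)
    (γ : Fin n → MvPowerSeries (Fin 1) k) (hγ : ∀ i, constantCoeff (γ i) = 0)
    (h : FixTrivialExp p e F (fun i => subst γ (θ i))) : FixTrivialExp p e (subst θ F) γ := by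
  have hθs : HasSubst θ := hasSubst_of_constantCoeff_zero hθ0
  have hγs : HasSubst γ := hasSubst_of_constantCoeff_zero hγ
  have hγ' : ∀ i, constantCoeff (subst γ (θ i)) = 0 := fun i => constantCoeff_subst_eq_zero hγs hγ (hθ0 i)
  obtain ⟨ψ, hψ0, hψθ, hθψ⟩ := exists_comp_inverse hθ0 hθdet
  have hψs : HasSubst ψ := hasSubst_of_constantCoeff_zero hψ0
  have hψdet : IsUnit (linMat ψ).det := by
    have hM := CobordantArc.linMat_mul_of_comp_eq_X (θ := θ) (ψ := ψ) hψ0 hψθ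
    have := congrArg Matrix.det hM
    rw [Matrix.det_mul, Matrix.det_one] at this
    exact IsUnit.of_mul_eq_one_right _ this
  have hFθψ : subst ψ (subst θ F) = F := by
    rw [subst_comp_subst_apply hθs hψs, funext hψθ]
    exact congr_fun subst_self F
  have h1 : FixTrivialExp p e (subst ψ (subst θ F)) (fun i => subst γ (θ i)) := by rw [hFθψ]; exact h
  have h2 := fixTrivialExp_transport p hp e (subst θ F) ψ hψ0 hψdet (fun i => subst γ (θ i)) hγ' h1
  have hpath : (fun i => subst (fun j => subst γ (θ j)) (ψ i)) = γ := by
    funext i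
    rw [← subst_comp_subst_apply hθs hγs, hθψ i, subst_X hγs]
  rwa [hpath] at h2

namespace TwistedTransport

/-- straightening a smooth arc transversal to `{x_{i₀} = 0}` onto the `x_{i₀}`-axis: `θ_j = [j ≠ i₀] x_j + γ_j(x_{i₀})` -/
noncomputable def straighten (γ : Fin n → MvPowerSeries (Fin 1) k) (i₀ : Fin n) : Fin n → MvPowerSeries (Fin n) k :=
  fun j => (if j = i₀ then 0 else X j) + subst (fun _ : Fin 1 => (X i₀ : MvPowerSeries (Fin n) k)) (γ j)

/-- The constant family `x_{i₀}` is substitutable. [OURS · L1 W4.3] -/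
theorem hasSubst_constX (i₀ : Fin n) : HasSubst (fun _ : Fin 1 => (X i₀ : MvPowerSeries (Fin n) k)) :=
  hasSubst_of_constantCoeff_zero fun _ => constantCoeff_X _

section straighten
variable (γ : Fin n → MvPowerSeries (Fin 1) k) (hγ : ∀ i, constantCoeff (γ i) = 0) (i₀ : Fin n)
include hγ

/-- `straighten` has no constant terms. [OURS · L1 W4.3] -/
theorem constantCoeff_straighten (j : Fin n) : constantCoeff (straighten γ i₀ j) = 0 := by
  unfold straighten
  rw [map_add, constantCoeff_subst_eq_zero (hasSubst_constX (k := k) i₀) (fun _ => constantCoeff_X _) (hγ j), add_zero]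
  split_ifs <;> simp

omit hγ in
/-- the straightening map carries the axis to the arc -/
theorem subst_axisCurve_straighten (j : Fin n) :
    subst (axisCurve (k := k) i₀) (straighten γ i₀ j) = γ j := by
  have has : HasSubst (axisCurve (k := k) i₀) :=
    hasSubst_of_constantCoeff_zero fun l => by unfold axisCurve; split_ifs <;> simp
  unfold straighten
  rw [subst_add has, subst_comp_subst_apply (hasSubst_constX (k := k) i₀) has]
  have h1 : subst (axisCurve (k := k) i₀) (if j = i₀ then (0 : MvPowerSeries (Fin n) k) else X j) = 0 := by
    split_ifs with hj
    · exact subst_zero' has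
    · rw [subst_X has]; unfold axisCurve; rw [if_neg hj]
  have h2 : (fun _ : Fin 1 => subst (axisCurve (k := k) i₀) (X i₀ : MvPowerSeries (Fin n) k)) =
      (X : Fin 1 → MvPowerSeries (Fin 1) k) := by
    funext l
    rw [subst_X has]
    unfold axisCurve
    rw [if_pos rfl, Fin.eq_zero l]
  rw [h1, zero_add, h2]
  exact congr_fun subst_self (γ j)

omit hγ in
/-- the linear part of the straightening map: the identity with column `i₀` replaced by `γ'(0)` -/
theorem linMat_straighten :
    linMat (straighten γ i₀) = (1 : Matrix (Fin n) (Fin n) k).updateCol i₀ fun j => coeff (Finsupp.single 0 1) (γ j) := by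
  classical
  ext j l
  simp only [linMat, Matrix.of_apply, Matrix.updateCol_apply, Matrix.one_apply]
  unfold straighten
  rw [map_add, CobordantArc.coeff_degree_one_subst _ (fun _ => constantCoeff_X _) (γ j) _ (by simp [Finsupp.degree_single]),
    Fin.sum_univ_one, coeff_single_X]
  by_cases hl : l = i₀
  · rw [if_pos hl, if_pos hl, mul_one]
    by_cases hj : j = i₀
    · rw [if_pos hj, map_zero, zero_add]
    · rw [if_neg hj, coeff_single_X, if_neg (fun h : l = j => hj (by rw [← h]; exact hl)), zero_add]
  · rw [if_neg hl, if_neg hl, mul_zero, add_zero]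
    by_cases hj : j = i₀
    · rw [if_pos hj, map_zero, if_neg (fun h : j = l => hl (h.symm.trans hj))]
    · rw [if_neg hj, coeff_single_X]
      by_cases hjl : j = l
      · rw [if_pos hjl, if_pos hjl.symm]
      · rw [if_neg hjl, if_neg (fun h : l = j => hjl h.symm)]

omit hγ in
/-- `det lin(straighten γ i₀) = γ_{i₀}'(0)`. [OURS · L1 W4.3] -/
theorem det_linMat_straighten : (linMat (straighten γ i₀)).det = coeff (Finsupp.single 0 1) (γ i₀) := by
  rw [linMat_straighten γ i₀, ← Matrix.cramer_apply, Matrix.cramer_eq_adjugate_mulVec, Matrix.adjugate_one,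
    Matrix.one_mulVec]

end straighten

end TwistedTransport

section smooth
variable (γ : Fin n → MvPowerSeries (Fin 1) k) (hγ : ∀ i, constantCoeff (γ i) = 0) (i₀ : Fin n)
include hγ

/-- **SMOOTH STRAIGHTENING + TRANSPORT**: an exponent-`e` Fix-trivialisation of `f` along a smooth arc `γ` transversal to `{x_{i₀}=0}`
is an exponent-`e` Fix-trivialisation of `f ∘ θ` along the `x_{i₀}`-axis, `θ` the straightening coordinate change. -/
theorem fixTrivialExp_axis_of_smooth (p : ℕ) (hp : p ≠ 0) (e : ℕ) (f : MvPowerSeries (Fin n) k)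
    (hsm : coeff (Finsupp.single 0 1) (γ i₀) ≠ 0) (h : FixTrivialExp p e f γ) :
    (∀ j, constantCoeff (straighten γ i₀ j) = 0) ∧ IsUnit (linMat (straighten γ i₀)).det ∧
      (fun j => subst (axisCurve (k := k) i₀) (straighten γ i₀ j)) = γ ∧
      FixTrivialExp p e (subst (straighten γ i₀) f) (axisCurve i₀) := by
  have h0 := constantCoeff_straighten γ hγ i₀
  have hdet : IsUnit (linMat (straighten γ i₀)).det := by
    rw [det_linMat_straighten γ i₀]; exact isUnit_iff_ne_zero.mpr hsm
  have hpath : (fun j => subst (axisCurve (k := k) i₀) (straighten γ i₀ j)) = γ :=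
    funext (subst_axisCurve_straighten γ i₀)
  refine ⟨h0, hdet, hpath, ?_⟩
  refine fixTrivialExp_transport_inv p hp e f (straighten γ i₀) h0 hdet _ ?_ ?_
  · intro l; unfold axisCurve; split_ifs <;> simp
  · rw [hpath]; exact h

end smooth

/-- DICTIONARY: the tree predicate is `∃ e, FixTrivialExp p e` (plus `γ(0) = 0`). [OURS · L1 W4.3] -/
theorem twistedTrivialAlongFix_iff_exists_fixTrivialExp (p : ℕ) (f : MvPowerSeries (Fin n) k)
    (γ : Fin n → MvPowerSeries (Fin 1) k) :
    TwistedTrivialAlongFix p f γ ↔ (∀ i, constantCoeff (γ i) = 0) ∧ ∃ e, FixTrivialExp p e f γ :=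
  Iff.rfl

end GradedGame

end Summit.ResolutionOfSingularities.ResolutionOfSingularities.Theorems
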